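import Summits.CriticalPhenomena.PercolationContinuityZ3.Theorems.PercNearOneGluingNoHeavyQuantBlockCombStrong
import HarnessLib

/-!
# QUANT lane R8, FAR on trees: the block-comb row for the whole CLASS `(Σ a)·x > 2j` (canonical model)

builds on p205010 (kernel theorem, internal audit signed; external expert review pending)

Support file (`--supports stmt-CriticalPhenomena-4575`), QUANT lane lead (gen 12); memo
`run/shared/lean/prim/quant/prim-quant-lead-g12/LEAD-NOTES-G12.md` N23.  Theorems only (local notation, no definitions),
no sorries, standard axioms.  Model and notation: `…QuantBlockCombMergeModel.lean` (chain gates `q`, levels `lv`, sizes `a`,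
private gates `g`, explicit tail `TAIL = P(N ≥ j+1)`); the strong-regime theorem: `…QuantBlockCombStrong.lean`
(`Quant.BlockComb.tail_ge_of_le_marg_strong`, prim-quant-p1 gen 8, p242699).

* `Quant.BlockComb.sum_wt_update_eq` — the configuration sum of a set function `F` is AFFINE in one private gate:
  changing `g s` to `t` changes `Σ_S wt S · F S` by `(t − g s) · Σ_{S ∌ s} wt₋ₛ S · (F (insert s S) − F S)`.
* `Quant.BlockComb.sum_wt_mono_gate` / `sum_wt_mono_gates` — hence for a set function `F` that is MONOTONE under
  inclusion, `Σ_S wt S · F S` is non-decreasing in one gate / in the whole gate vector (gates in `[0,1]`).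
* `Quant.BlockComb.tail_nonneg`, `Quant.BlockComb.tail_mono_gates` — the tail `P(N ≥ j+1)` of the block-comb count is
  nonnegative and non-decreasing in the private gates (the crossing event is increasing).
* **`Quant.BlockComb.tail_ge_of_class`** — FAR at every layer for EVERY block-comb of the class: if `x` is below every
  live marginal `(∏_{i<lv k} q i)·g k` and `2j < (Σ_k a k)·x`, then `x ≤ TAIL`.  Proof: lower every live private gate to its
  tied floor `x / ∏_{i<lv k} q i` (which is `≥ x ≥ 2j/Σ a` because a prefix product of gates is `≤ 1`, so the lowered vector
  satisfies the strong hypothesis of p242699 with every live marginal equal to `x`), apply `tail_ge_of_le_marg_strong`, and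
  come back up by `tail_mono_gates`.  This is lead g11's target of record (GBS) for block-combs (LEAD-NOTES-G11 N22 (1d)) in
  the canonical model: inside the class nothing needs to be tied or glued; the only block-comb regime left open is the
  budget-binding one (LEAD-NOTES-G10 N21 (6): some private gate `≤ 2j/Σ a`, mean carried by raised marginals).
-/

namespace Summit.CriticalPhenomena.PercolationContinuityZ3.Theorems

namespace Quant

namespace BlockComb

open Finset

variable {κ : Type*} [Fintype κ] [DecidableEq κ]

/-- product-Bernoulli weight of the set `S` of open blob gates -/
local notation3 "wt[" g ", " S "]" => ∏ k, (if k ∈ (S : Finset κ) then (g : κ → ℝ) k else 1 - (g : κ → ℝ) k)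

/-- the same weight with the gate of `s` removed -/
local notation3 "wt'[" g ", " s ", " S "]" =>
  ∏ k ∈ (Finset.univ : Finset κ).erase s, (if k ∈ (S : Finset κ) then (g : κ → ℝ) k else 1 - (g : κ → ℝ) k)

/-- probability that the chain `q` of length `D` is open exactly to depth `i` -/
local notation3 "pd[" D ", " q ", " i "]" =>
  (∏ i' ∈ Finset.range (i : ℕ), (q : ℕ → ℝ) i') * (if (i : ℕ) < (D : ℕ) then 1 - (q : ℕ → ℝ) i else 1)

/-- mass counted at depth `i` in blob configuration `S` -/
local notation3 "mass[" lv ", " a ", " i ", " S "]" =>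
  ∑ k ∈ (S : Finset κ).filter (fun k => (lv : κ → ℕ) k ≤ (i : ℕ)), ((a : κ → ℕ) k : ℕ)

/-- the tail `P(N ≥ j+1)` of the block-comb count, as an explicit finite sum -/
local notation3 "TAIL[" D ", " q ", " lv ", " a ", " g ", " j "]" =>
  ∑ i ∈ Finset.range ((D : ℕ) + 1), pd[D, q, i] *
    ∑ S : Finset κ, wt[g, S] * (if (j : ℕ) + 1 ≤ mass[lv, a, i, S] then (1 : ℝ) else 0)

/-! ### 1. The configuration sum is affine in each private gate -/

/-- The weight without the gate of `s` does not depend on the value of that gate. [folklore] -/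
theorem wt'_update (g : κ → ℝ) (s : κ) (t : ℝ) (S : Finset κ) :
    wt'[Function.update g s t, s, S] = wt'[g, s, S] := by
  refine Finset.prod_congr rfl fun k hk => ?_
  have hks : k ≠ s := Finset.ne_of_mem_erase hk
  rw [Function.update_of_ne hks]

/-- **Affine in one gate.**  Replacing the gate `g s` by `t` changes the configuration sum of any set function `F` by
`(t − g s)·Σ_{S ∌ s} wt₋ₛ S·(F (insert s S) − F S)`. [folklore] -/
theorem sum_wt_update_eq (g : κ → ℝ) (s : κ) (t : ℝ) (F : Finset κ → ℝ) :
    ∑ S : Finset κ, wt[Function.update g s t, S] * F S =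
      ∑ S : Finset κ, wt[g, S] * F S +
        (t - g s) * ∑ S : Finset κ, (if s ∈ S then 0 else wt'[g, s, S] * (F (insert s S) - F S)) := by
  rw [sum_wt_split (Function.update g s t) s F, sum_wt_split g s F, Finset.mul_sum, ← Finset.sum_add_distrib]
  refine Finset.sum_congr rfl fun S _ => ?_
  by_cases hsS : s ∈ S
  · rw [if_pos hsS, if_pos hsS, if_pos hsS, mul_zero, add_zero]
  · rw [if_neg hsS, if_neg hsS, if_neg hsS, wt'_update, Function.update_self]
    ring

/-- **Monotone in one gate.**  For a set function `F` that is monotone under inclusion and gates in `[0,1]`, raising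
the gate of `s` from `g s` to `t ≥ g s` does not decrease `Σ_S wt S·F S`. [folklore] -/
theorem sum_wt_mono_gate (g : κ → ℝ) (hg : ∀ k, 0 ≤ g k ∧ g k ≤ 1) (s : κ) (t : ℝ) (hst : g s ≤ t)
    (F : Finset κ → ℝ) (hF : ∀ S T : Finset κ, S ⊆ T → F S ≤ F T) :
    ∑ S : Finset κ, wt[g, S] * F S ≤ ∑ S : Finset κ, wt[Function.update g s t, S] * F S := by
  rw [sum_wt_update_eq g s t F]
  have hsum : 0 ≤ ∑ S : Finset κ, (if s ∈ S then 0 else wt'[g, s, S] * (F (insert s S) - F S)) := by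
    refine Finset.sum_nonneg fun S _ => ?_
    split_ifs
    · exact le_rfl
    · exact mul_nonneg (wt'_nonneg g hg s S) (sub_nonneg.2 (hF S (insert s S) (Finset.subset_insert s S)))
  nlinarith [mul_nonneg (sub_nonneg.2 hst) hsum]

/-- **Monotone in the gate vector.**  For a set function `F` monotone under inclusion, if `g' k ≤ g k` for every `k`
(both gate vectors in `[0,1]`) then `Σ_S wt[g'] S·F S ≤ Σ_S wt[g] S·F S`. [folklore] -/
theorem sum_wt_mono_gates (g g' : κ → ℝ) (hg : ∀ k, 0 ≤ g k ∧ g k ≤ 1) (hg' : ∀ k, 0 ≤ g' k ∧ g' k ≤ 1)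
    (hle : ∀ k, g' k ≤ g k) (F : Finset κ → ℝ) (hF : ∀ S T : Finset κ, S ⊆ T → F S ≤ F T) :
    ∑ S : Finset κ, wt[g', S] * F S ≤ ∑ S : Finset κ, wt[g, S] * F S := by
  -- hybrid gate vectors: `g` on `T`, `g'` off `T`
  let hyb : Finset κ → κ → ℝ := fun T k => if k ∈ T then g k else g' k
  have hhyb01 : ∀ T k, 0 ≤ hyb T k ∧ hyb T k ≤ 1 := by
    intro T k
    show 0 ≤ (if k ∈ T then g k else g' k) ∧ (if k ∈ T then g k else g' k) ≤ 1
    split_ifs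
    · exact hg k
    · exact hg' k
  have hstep : ∀ T : Finset κ,
      ∑ S : Finset κ, wt[g', S] * F S ≤ ∑ S : Finset κ, wt[hyb T, S] * F S := by
    intro T
    induction T using Finset.induction_on with
    | empty =>
      have h0 : hyb ∅ = g' := by
        funext k
        show (if k ∈ (∅ : Finset κ) then g k else g' k) = g' k
        rw [if_neg (Finset.notMem_empty k)]
      rw [h0]
    | insert s T hs ih =>
      have hupd : hyb (insert s T) = Function.update (hyb T) s (g s) := by
        funext k
        by_cases hks : k = s
        · subst hks
          rw [Function.update_self]
          show (if k ∈ insert k T then g k else g' k) = g k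
          rw [if_pos (Finset.mem_insert_self k T)]
        · rw [Function.update_of_ne hks]
          show (if k ∈ insert s T then g k else g' k) = (if k ∈ T then g k else g' k)
          simp only [Finset.mem_insert, hks, false_or]
      have hgs : hyb T s ≤ g s := by
        show (if s ∈ T then g s else g' s) ≤ g s
        rw [if_neg hs]
        exact hle s
      rw [hupd]
      exact ih.trans (sum_wt_mono_gate (hyb T) (hhyb01 T) s (g s) hgs F hF)
  have huniv : hyb Finset.univ = g := by
    funext k
    show (if k ∈ (Finset.univ : Finset κ) then g k else g' k) = g k
    rw [if_pos (Finset.mem_univ k)]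
  have := hstep Finset.univ
  rw [huniv] at this
  exact this

/-! ### 2. The tail is nonnegative and non-decreasing in the private gates -/

omit [Fintype κ] [DecidableEq κ] in
/-- The crossing indicator at depth `i` is monotone under inclusion of blob configurations. [folklore] -/
theorem crossIndicator_mono (lv : κ → ℕ) (a : κ → ℕ) (i j : ℕ) (S T : Finset κ) (hST : S ⊆ T) :
    (if (j : ℕ) + 1 ≤ mass[lv, a, i, S] then (1 : ℝ) else 0) ≤
      (if (j : ℕ) + 1 ≤ mass[lv, a, i, T] then (1 : ℝ) else 0) := by
  have hmass : mass[lv, a, i, S] ≤ mass[lv, a, i, T] :=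
    Finset.sum_le_sum_of_subset (Finset.filter_subset_filter _ hST)
  by_cases hS : j + 1 ≤ mass[lv, a, i, S]
  · rw [if_pos hS, if_pos (hS.trans hmass)]
  · rw [if_neg hS]
    split_ifs <;> norm_num

/-- The tail `P(N ≥ j+1)` is nonnegative (gates and chain gates in `[0,1]`). [folklore] -/
theorem tail_nonneg (D : ℕ) (q : ℕ → ℝ) (hq : ∀ i, 0 ≤ q i ∧ q i ≤ 1) (lv : κ → ℕ) (a : κ → ℕ)
    (g : κ → ℝ) (hg : ∀ k, 0 ≤ g k ∧ g k ≤ 1) (j : ℕ) : 0 ≤ TAIL[D, q, lv, a, g, j] :=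
  Finset.sum_nonneg fun i _ => mul_nonneg (pd_nonneg D q hq i)
    (Finset.sum_nonneg fun S _ => mul_nonneg (wt_nonneg g hg S) (by split_ifs <;> norm_num))

/-- **The tail is non-decreasing in the private gates**: if `g' k ≤ g k` for every blob (both in `[0,1]`) then
`TAIL[g'] ≤ TAIL[g]` (the event `{N ≥ j+1}` is increasing in the blob indicators). [this work] -/
theorem tail_mono_gates (D : ℕ) (q : ℕ → ℝ) (hq : ∀ i, 0 ≤ q i ∧ q i ≤ 1) (lv : κ → ℕ) (a : κ → ℕ)
    (g g' : κ → ℝ) (hg : ∀ k, 0 ≤ g k ∧ g k ≤ 1) (hg' : ∀ k, 0 ≤ g' k ∧ g' k ≤ 1) (hle : ∀ k, g' k ≤ g k) (j : ℕ) :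
    TAIL[D, q, lv, a, g', j] ≤ TAIL[D, q, lv, a, g, j] := by
  refine Finset.sum_le_sum fun i _ => mul_le_mul_of_nonneg_left ?_ (pd_nonneg D q hq i)
  exact sum_wt_mono_gates g g' hg hg' hle _ (fun S T hST => crossIndicator_mono lv a i j S T hST)

/-! ### 3. FAR for every block-comb of the class `(Σ a)·x > 2j` -/

/-- A prefix product of chain gates in `[0,1]` lies in `[0,1]`. [folklore] -/
theorem prefixProd_mem (q : ℕ → ℝ) (hq : ∀ i, 0 ≤ q i ∧ q i ≤ 1) (n : ℕ) :
    0 ≤ ∏ i ∈ Finset.range n, q i ∧ ∏ i ∈ Finset.range n, q i ≤ 1 :=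
  ⟨Finset.prod_nonneg fun i _ => (hq i).1, Finset.prod_le_one (fun i _ => (hq i).1) fun i _ => (hq i).2⟩

/-- **THEOREM (FAR at every layer for every block-comb of the class, canonical model).**  For a chain `q` of `D`
gates and blobs `k` with levels `lv k ≤ D`, sizes `a k` and private gates `g k`: if `x` is at most every live marginal
`(∏_{i<lv k} q i)·g k` and `2j < (Σ_k a k)·x`, then `x ≤ P(N ≥ j+1)`.  In `Quant.FarRelayRow`'s normal form `x = 1 − t` is
the least marginal and `(Σ a)·x > 2j` says the mean counted AT THE FLOOR exceeds `2j` (lead g11's class; it contains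
every all-tied block-comb).  Proof: lower each live gate to its tied floor `x/∏_{i<lv k} q i ≥ x > 2j/Σ a`, apply the
strong-regime theorem `tail_ge_of_le_marg_strong` (p242699) to the lowered gates (every live marginal is then exactly
`x`), and return by `tail_mono_gates`. [this work] -/
theorem tail_ge_of_class (D : ℕ) (q : ℕ → ℝ) (hq : ∀ i, 0 ≤ q i ∧ q i ≤ 1) (lv : κ → ℕ) (a : κ → ℕ)
    (g : κ → ℝ) (hg : ∀ k, 0 ≤ g k ∧ g k ≤ 1) (j : ℕ) (hlv : ∀ k, 0 < a k → lv k ≤ D)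
    (x : ℝ) (hx : ∀ k, 0 < a k → x ≤ (∏ i ∈ Finset.range (lv k), q i) * g k)
    (hclass : (2 * j : ℝ) < (∑ k', (a k' : ℝ)) * x) (hne : ∃ k, 0 < a k) :
    x ≤ TAIL[D, q, lv, a, g, j] := by
  have hA0 : 0 ≤ ∑ k', (a k' : ℝ) := Finset.sum_nonneg fun k _ => Nat.cast_nonneg _
  -- `x > 0`: otherwise `2j < (Σ a)·x ≤ 0` is impossible
  have hxpos : 0 < x := by
    by_contra hx0
    push Not at hx0
    have h1 : (∑ k', (a k' : ℝ)) * x ≤ 0 := mul_nonpos_of_nonneg_of_nonpos hA0 hx0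
    have h2 : (0 : ℝ) ≤ 2 * j := by positivity
    linarith
  -- the lowered (tied) gate vector
  let g' : κ → ℝ := fun k => if 0 < a k then x / ∏ i ∈ Finset.range (lv k), q i else g k
  -- live prefix products are positive
  have hPpos : ∀ k, 0 < a k → 0 < ∏ i ∈ Finset.range (lv k), q i := by
    intro k hk
    rcases (prefixProd_mem q hq (lv k)).1.lt_or_eq with h | h
    · exact h
    · exfalso
      have := hx k hk
      rw [← h, zero_mul] at this
      linarith
  have hg'live : ∀ k, 0 < a k → g' k = x / ∏ i ∈ Finset.range (lv k), q i := fun k hk => if_pos hk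
  have hg'dead : ∀ k, ¬ 0 < a k → g' k = g k := fun k hk => if_neg hk
  -- `g' ≤ g`
  have hle : ∀ k, g' k ≤ g k := by
    intro k
    by_cases hk : 0 < a k
    · rw [hg'live k hk, div_le_iff₀ (hPpos k hk), mul_comm]
      exact hx k hk
    · rw [hg'dead k hk]
  -- `g'` in `[0,1]`
  have hg' : ∀ k, 0 ≤ g' k ∧ g' k ≤ 1 := by
    intro k
    refine ⟨?_, (hle k).trans (hg k).2⟩
    by_cases hk : 0 < a k
    · rw [hg'live k hk]
      exact div_nonneg hxpos.le (hPpos k hk).le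
    · rw [hg'dead k hk]
      exact (hg k).1
  -- the strong hypothesis for `g'`: `x/∏q ≥ x` since `∏q ≤ 1`
  have hstrong : ∀ k, 0 < a k → (2 * j : ℝ) < (∑ k', (a k' : ℝ)) * g' k := by
    intro k hk
    rw [hg'live k hk]
    have hxle : x ≤ x / ∏ i ∈ Finset.range (lv k), q i := by
      rw [le_div_iff₀ (hPpos k hk)]
      have := mul_le_mul_of_nonneg_left (prefixProd_mem q hq (lv k)).2 hxpos.le
      simpa using this
    exact hclass.trans_le (mul_le_mul_of_nonneg_left hxle hA0)
  -- every live marginal of `g'` equals `x`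
  have hx' : ∀ k, 0 < a k → x ≤ (∏ i ∈ Finset.range (lv k), q i) * g' k := by
    intro k hk
    rw [hg'live k hk, mul_div_cancel₀ x (hPpos k hk).ne']
  calc x ≤ TAIL[D, q, lv, a, g', j] := tail_ge_of_le_marg_strong D q hq lv a g' hg' j hlv hstrong hne x hx'
    _ ≤ TAIL[D, q, lv, a, g, j] := tail_mono_gates D q hq lv a g g' hg hg' hle j

/-- **COROLLARY (least-marginal form).**  With `x` the least live marginal itself — i.e. `x ≤` every live marginal
and `x =` one of them — the same conclusion; stated for convenience of the typer's wrappers (`Quant.FarTreeRow` /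
`Quant.FarRelayRow` normal form: `x = 1 − t`, cuts `≤ t`, `EN ≥ (Σ a)·x > 2j`). [this work] -/
theorem tail_ge_leastMarg_of_class (D : ℕ) (q : ℕ → ℝ) (hq : ∀ i, 0 ≤ q i ∧ q i ≤ 1) (lv : κ → ℕ) (a : κ → ℕ)
    (g : κ → ℝ) (hg : ∀ k, 0 ≤ g k ∧ g k ≤ 1) (j : ℕ) (hlv : ∀ k, 0 < a k → lv k ≤ D)
    (k₀ : κ) (hk₀ : 0 < a k₀)
    (hmin : ∀ k, 0 < a k →
      (∏ i ∈ Finset.range (lv k₀), q i) * g k₀ ≤ (∏ i ∈ Finset.range (lv k), q i) * g k)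
    (hclass : (2 * j : ℝ) < (∑ k', (a k' : ℝ)) * ((∏ i ∈ Finset.range (lv k₀), q i) * g k₀)) :
    (∏ i ∈ Finset.range (lv k₀), q i) * g k₀ ≤ TAIL[D, q, lv, a, g, j] :=
  tail_ge_of_class D q hq lv a g hg j hlv _ hmin hclass ⟨k₀, hk₀⟩

end BlockComb

end Quant

end Summit.CriticalPhenomena.PercolationContinuityZ3.Theorems
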